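import Literature.AlgebraicGeometry.Frobenioids.ArchimedeanFSMFFAssemblyA
import Literature.AlgebraicGeometry.Frobenioids.ArchimedeanFSMFFAssemblyN
import Literature.AlgebraicGeometry.Frobenioids.ArchimedeanFSMFFTransfer
import Literature.AlgebraicGeometry.Frobenioids.ArchimedeanFSMFFPiecesR
import Literature.AlgebraicGeometry.Frobenioids.ArchimedeanFSMChainBound
import Literature.AlgebraicGeometry.Frobenioids.ArchimedeanFSMRepaired
import Literature.AlgebraicGeometry.Frobenioids.ArchimedeanFSMOverIsoProofs
import Literature.AlgebraicGeometry.Frobenioids.ArchimedeanFSMPullbackFSMI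
import Literature.AlgebraicGeometry.Frobenioids.ArchimedeanF0FSMFactorization
import Literature.AlgebraicGeometry.Frobenioids.ArchimedeanF0FSMFactorizationR0
import Literature.AlgebraicGeometry.Frobenioids.ArchimedeanF0FSMFactorizationA0
import Literature.AlgebraicGeometry.Frobenioids.ArchimedeanFSMIChainsA0
import Literature.AlgebraicGeometry.Frobenioids.ArchimedeanFSMIChainsR0
import Literature.AlgebraicGeometry.Frobenioids.ArchimedeanRCConnected
import HarnessLib

/-!
# Frobenioids II, Proposition 3.4 (viii) in the COMPLEX REGIME for `F = A, N, R` — CLOSED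
# (abc-iut cell, layer L1, node `FrdII:Prop3.4(viii)`: sub-nodes P34-L10/L11 (w5-d092), P34-L12 (w5-d146),
# P34-L13/L14 (w5-d152), P34-L09 (d3 `ArchimedeanRCConnected`, t6 `isTotallyEpimorphic_all`) assembled)

Mochizuki, *The geometry of Frobenioids II: poly-Frobenioids*, Kyushu J. Math. **62** (2008)
401–460, §3, Proposition 3.4 (viii) p. 30, proof pp. 32–33 [cite: MochizukiFrdII2008, Prop 3.4 (viii) p.33].

PROOF-ONLY file (nothing is defined). The typed item (viii) is refuted as typed at `π = 𝟭 D₀`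
(`ArchFrd.not_prop34_viii_id`, abc-iut-L1-d3); the cell's repaired reading is the COMPLEX REGIME (every
object of `D` lies over `Spec ℂ`, as for the archimedean places of a number field containing `√−1`;
ruling L1-lead R37, `prop34_iii_of_isComplex`). Here the assembled theorems `A.isOfFSMFFType`,
`N.isOfFSMFFType` (files `ArchimedeanFSMFFAssembly{A,N}.lean`) — and, for `R`, the same assembly
performed in place from the model pieces `ArchimedeanFSMFFPiecesR.lean` by the abstract transfer
`FSMFFTransfer.exists_isFSMIChain_of_isFSM` and the chain bound `Tower.exists_headedChain_bound`
(exactly the recipe of `R.isOfFSMFFType` in `ArchimedeanFSMFFAssemblyR.lean`, which this file does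
not import) — have their
typed-item hypotheses DISCHARGED by the landed proofs — (iii) `prop34_iii_of_isComplex` (d3), (iv)
`prop34_iv_holds` (w5-d101), (v) `A/N/R.propV` for `D` totally epimorphic (w4-d092), (vi) `A/N/R.propVI`
(d3/t6), (vii) `prop34_vii_holds` (w5-d101) — leaving, besides "`D` totally epimorphic, of FSMFF-type (2024)" and the complex regime (which makes
"`D` complexifiable" vacuous: `rc_isComplexifiable_of_isComplex`), ONLY the portion of (viii) concerning `F₀` (p. 32 ll. 5–47),
stated in `F₀`'s own terms: FSMI-morphisms of `F₀` have complex domain and codomain (P34-L10),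
condition (a) of `F₀` at complex codomain (P34-L12) and condition (b) of `F₀` (P34-L10/L11). The
reduced forms `A/N/R.isOfFSMFFType_of_isComplex` keep that `F₀`-portion as hypotheses (for `N₀`, `R₀`
with condition (a) already discharged by w5-d146's `N0./R0.exists_isFSMIChain_of_isFSM`); the primed
forms `A/N/R.isOfFSMFFType_of_isComplex'` DISCHARGE it by the landed `A0/N0/R0.isComplexObj_of_isFSMI`,
`A0/N0/R0.bounded_headedFSMIChain` (w5-d092, `ArchimedeanFSMIChains{A0,N0,R0}`) and
`A0.exists_isFSMIChain_of_isFSM` (w5-d146, `ArchimedeanF0FSMFactorizationA0`). Finally the other three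
printed conclusions of (viii) — `F` complexifiable (vacuous in the complex regime,
`Tower.rc_isComplexifiable_of_isComplex`), RC-connected (`A/N/R.isRCConnected`, d3), totally epimorphic
(`isTotallyEpimorphic_all`, t6) — are attached: `A/N/R.propVIII_conclusion_of_isComplex`, and
**`prop34_viii_of_isComplex`**: the typed item `Prop34_viii π` ITSELF holds whenever every object of `D`
lies over `Spec ℂ`, `D` is totally epimorphic ([FrdII] Ex. 3.3 (i) standing hypothesis) and `D` is of
FSMFF-type in the author's REVISED (2024) sense — the typed hypotheses "`D` complexifiable" and "of
FSMFF-type (2008)" being then unnecessary resp. superseded (the 2008 condition (b) does not transfer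
along the tower; the 2024 one does, `ArchimedeanFSMChainBound.lean`). As typed without these hypotheses
the item is refuted at `π = 𝟭 D₀` (`ArchFrd.not_prop34_viii_id`). No side is taken on [IUTchIII] Cor. 3.12.
-/

namespace Literature.AlgebraicGeometry.Frobenioids

open CategoryTheory

noncomputable section

namespace ArchFrd

universe v u

variable {D : Type u} [Category.{v} D] (π : D ⥤ D0)

/-- In the complex regime `D → D₀` is complexifiable (Def. 3.1 (v)) — vacuously: there are no real
objects. [cite: MochizukiFrdII2008, Def 3.1 (v) p.25] -/
theorem rc_isComplexifiable_of_isComplex (hD : ∀ d : D, (π.obj d).IsComplex) :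
    RC.IsComplexifiable (π ⋙ D0.toArchBase) :=
  ⟨fun d hd => by
    have h1 : π.obj d = D0.real := (D0.realObjects_comp_iff π d).mp hd
    have h2 : π.obj d = D0.complex := hD d
    exact absurd (h1.symm.trans h2) (by decide)⟩

/-- In the complex regime the `C₀`-component of every object of `C = C₀ ×_{D₀} D` is complex (its base is
isomorphic to the image of the `D`-component). [cite: MochizukiFrdII2008, Ex 3.3 (ii) p.28] -/
theorem C.isComplexObj_fst_of_isComplex (hD : ∀ d : D, (π.obj d).IsComplex) (X : C π) :
    X.fst.IsComplexObj :=
  D0.isComplex_of_iso X.iso.inv (hD X.snd)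

/-- An arrow of `C₀` between complex objects lies over an isomorphism of `D₀`.
[cite: MochizukiFrdII2008, Def 3.1 (i) p.23] -/
theorem C0.isBaseIso_of_isComplexObj {U V : C0} (f : U ⟶ V) (hU : U.IsComplexObj)
    (hV : V.IsComplexObj) : PreFrobenioid.IsBaseIso C0.toElem f :=
  D0.isIso_of_isComplex (C0.Base f) hU hV

/-- **[FrdII] Prop. 3.4 (viii) for `F = A` in the complex regime, reduced to the `A₀`-portion**: if every
object of `D` lies over `Spec ℂ` (then `D` is complexifiable vacuously), `D` is totally epimorphic and of
FSMFF-type (2024),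
and `A₀` satisfies — FSMI-morphisms have complex ends, condition (a) at complex codomain, condition (b)
— then the angular Frobenioid `A = A₀ ×_{D₀} D` is of FSMFF-type.
[cite: MochizukiFrdII2008, Prop 3.4 (viii) p.33] -/
theorem A.isOfFSMFFType_of_isComplex (hD : ∀ d : D, (π.obj d).IsComplex) (hte : IsTotallyEpimorphic D)
    (hFF : IsOfFSMFFType2024 D)
    (hcx : ∀ {U V : A0} (ε : U ⟶ V), IsFSMI ε → U.obj.IsComplexObj ∧ V.obj.IsComplexObj)
    (ha : ∀ {U V : A0}, V.obj.IsComplexObj → ∀ (ψ : U ⟶ V), IsFSM ψ → ¬ IsIso ψ →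
      ∃ n, IsFSMIChain ψ n)
    (hb : ∀ U : A0, ∃ N : ℕ, ∀ {V : A0} (ψ : U ⟶ V) (n : ℕ), IsHeadedFSMIChain ⊤ ψ n → n ≤ N) :
    IsOfFSMFFType (A π) :=
  A.isOfFSMFFType π (prop34_iii_of_isComplex π hD).1 (prop34_iv_holds π).1
    (rc_isComplexifiable_of_isComplex π hD) (A.propV π hte)
    (prop34_vii_holds π).1 hFF
    (fun ε hε => C0.isBaseIso_of_isComplexObj ε.hom (hcx ε hε).1 (hcx ε hε).2)
    (fun {_ Z} ψ₀ hψ hψ' => ha (C.isComplexObj_fst_of_isComplex π hD Z.obj) ψ₀ hψ hψ')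
    (fun _ => hb _)

/-- **[FrdII] Prop. 3.4 (viii) for `F = N` in the complex regime, reduced to the `N₀`-portion**, with
condition (a) of `N₀` at complex codomain DISCHARGED (`N0.exists_isFSMIChain_of_isFSM`): the remaining
`N₀`-inputs are "FSMI-morphisms have complex ends" and condition (b).
[cite: MochizukiFrdII2008, Prop 3.4 (viii) p.33] -/
theorem N.isOfFSMFFType_of_isComplex (hD : ∀ d : D, (π.obj d).IsComplex) (hte : IsTotallyEpimorphic D)
    (hFF : IsOfFSMFFType2024 D)
    (hcx : ∀ {U V : N0} (ε : U ⟶ V), IsFSMI ε → U.carrier.IsComplexObj ∧ V.carrier.IsComplexObj)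
    (hb : ∀ U : N0, ∃ N : ℕ, ∀ {V : N0} (ψ : U ⟶ V) (n : ℕ), IsHeadedFSMIChain ⊤ ψ n → n ≤ N) :
    IsOfFSMFFType (N π) :=
  N.isOfFSMFFType π (prop34_iii_of_isComplex π hD).2.1 (prop34_iv_holds π).2.1
    (rc_isComplexifiable_of_isComplex π hD) (N.propV π hte)
    (prop34_vii_holds π).2.1 hFF
    (fun ε hε => C0.isBaseIso_of_isComplexObj (N0.homCarrier ε) (hcx ε hε).1 (hcx ε hε).2)
    (fun {_ Z} ψ₀ hψ hψ' =>
      N0.exists_isFSMIChain_of_isFSM (C.isComplexObj_fst_of_isComplex π hD Z.obj.obj) ψ₀ hψ hψ')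
    (fun _ => hb _)

/-- **[FrdII] Prop. 3.4 (viii) for `F = R` in the complex regime, reduced to the `R₀`-portion**, with
condition (a) of `R₀` at complex codomain DISCHARGED (`R0.exists_isFSMIChain_of_isFSM`, w5-d146): the
remaining `R₀`-inputs are "FSMI-morphisms have complex ends" and condition (b).
[cite: MochizukiFrdII2008, Prop 3.4 (viii) p.33] -/
theorem R.isOfFSMFFType_of_isComplex (hD : ∀ d : D, (π.obj d).IsComplex) (hte : IsTotallyEpimorphic D)
    (hFF : IsOfFSMFFType2024 D)
    (hcx : ∀ {U V : R0} (ε : U ⟶ V), IsFSMI ε →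
      (R0.toC0.obj U).IsComplexObj ∧ (R0.toC0.obj V).IsComplexObj)
    (hb : ∀ U : R0, ∃ N : ℕ, ∀ {V : R0} (ψ : U ⟶ V) (n : ℕ), IsHeadedFSMIChain ⊤ ψ n → n ≤ N) :
    IsOfFSMFFType (R π) := by
  -- The typed items, DISCHARGED (complex regime).
  have hIII : (towerR π).PropIII := (prop34_iii_of_isComplex π hD).2.2
  have hIV : (towerR π).PropIV := (prop34_iv_holds π).2.2
  have hc : RC.IsComplexifiable (π ⋙ D0.toArchBase) := rc_isComplexifiable_of_isComplex π hD
  have hV : (towerR π).PropV := R.propV π hte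
  have hVII : (towerR π).PropVII := (prop34_vii_holds π).2.2
  -- The `R₀`-portion: FSMI-morphisms of `R₀` lie over isomorphisms of `D₀` (complex ends), and
  -- condition (a) of `R₀` at complex codomain (w5-d146).
  have h10 : ∀ {U V : R0} (ε : U ⟶ V), IsFSMI ε →
      PreFrobenioid.IsBaseIso C0.toElem (R0.toC0.map ε) :=
    fun ε hε => C0.isBaseIso_of_isComplexObj (R0.toC0.map ε) (hcx ε hε).1 (hcx ε hε).2
  have ha₀ : ∀ {X Z : (towerR π).F} (ψ₀ : (towerR π).toF0.obj X ⟶ (towerR π).toF0.obj Z),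
      IsFSM ψ₀ → ¬ IsIso ψ₀ → ∃ n, IsFSMIChain ψ₀ n :=
    fun {_ Z} ψ₀ hψ hψ' =>
      R0.exists_isFSMIChain_of_isFSM (C.isComplexObj_fst_of_isComplex π hD ((R.toC π).obj Z)) ψ₀ hψ hψ'
  -- Condition (a) for `R`, assembled from the model pieces of `ArchimedeanFSMFFPiecesR.lean` by the
  -- abstract transfer `FSMFFTransfer.exists_isFSMIChain_of_isFSM` (the recipe of
  -- `R.exists_isFSMIChain_of_isFSM` in `ArchimedeanFSMFFAssemblyR.lean`, inlined so that this file
  -- does not import that module).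
  have ha : ∀ {X Y : (towerR π).F} (φ : X ⟶ Y), IsFSM φ → ¬ IsIso φ → ∃ n, IsFSMIChain φ n :=
    fun φ hφ hφiso =>
      FSMFFTransfer.exists_isFSMIChain_of_isFSM (towerR π).toD (towerR π).toF0
        (fun {_ _} α => PreFrobenioid.IsPullbackMorphism C0.toElem (R0.toC0.map α.fst))
        (fun φ => R.exists_fac_pullback π φ)
        (fun α hP hD => R.mono_of_isPullbackMorphism_fst π α hP hD)
        (fun α hP hD => R.isIso_of_isPullbackMorphism_fst_of_isIso_snd π α hP hD)
        (fun ψ hD h0 => R.isIso_of_isIso_proj π ψ hD h0)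
        (fun φ hφ => hIII φ hφ)
        (fun β hG hβ => ((hIV hc β hG).1 hβ))
        (fun {_ _} β _ {_} ε χ hfac hε => R.exists_lift_toR0_fac π β ε χ hfac (h10 ε hε))
        (fun ψ hD h0 => R.mono_of_isIso_snd_of_mono_toR0 π ψ hD h0)
        (fun ψ hD hψ h0 => (towerR π).isFSMI_of_propV hV ψ hD hψ h0)
        (fun {_ _} α hP {_} δ χ hfac => R.exists_factor_pullback π α hP δ χ hfac)
        (fun α hP hD => R.isFSMI_of_isPullbackMorphism_fst_of_propVII π hVII α hP hD)
        hFF.factors ha₀ φ hφ hφiso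
  -- Condition (b) by the chain bound (`ArchimedeanFSMChainBound.lean`), then 2024 ⇒ 2008.
  exact ((towerR π).isOfFSMFFType2024_of_pieces ha
    ((towerR π).exists_headedChain_bound
      ((towerR π).propVI_FSMI_of_propVI_of_propIII (R.propVI π) hIII)
      (fun φ hφ hiso => (towerR π).isFSMI_toF0_of_propIV hIV hc φ hφ hiso)
      (fun _ => hFF.bounded _) (fun _ => hb _))).isOfFSMFFType

/-! ### The finals: every input discharged -/

/-- In the complex regime every tower `F → D → D₀` is complexifiable — vacuously (no object of `F` lies
over `Spec ℝ`). [cite: MochizukiFrdII2008, Def 3.1 (v) p.25] -/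
theorem Tower.rc_isComplexifiable_of_isComplex (T : Tower π) (hD : ∀ d : D, (π.obj d).IsComplex) :
    RC.IsComplexifiable (T.toD0 ⋙ D0.toArchBase) :=
  ⟨fun X hX => by
    have h1 : (T.toD ⋙ π).obj X = D0.real := (D0.realObjects_comp_iff (T.toD ⋙ π) X).mp hX
    have h2 : π.obj (T.toD.obj X) = D0.complex := hD _
    exact absurd (h1.symm.trans h2) (by decide)⟩

/-- **[FrdII] Prop. 3.4 (viii), `F = N`, complex regime — the FSMFF conclusion, CLOSED**: if every object
of `D` lies over `Spec ℂ` and `D` is totally epimorphic and of FSMFF-type (2024), then `N = N₀ ×_{D₀} D`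
is of FSMFF-type. [cite: MochizukiFrdII2008, Prop 3.4 (viii) p.30] -/
theorem N.isOfFSMFFType_of_isComplex' (hD : ∀ d : D, (π.obj d).IsComplex)
    (hte : IsTotallyEpimorphic D) (hFF : IsOfFSMFFType2024 D) : IsOfFSMFFType (N π) :=
  N.isOfFSMFFType_of_isComplex π hD hte hFF (fun ε hε => N0.isComplexObj_of_isFSMI ε hε)
    N0.bounded_headedFSMIChain

/-- **[FrdII] Prop. 3.4 (viii), `F = A`, complex regime — the FSMFF conclusion, CLOSED**: if every object
of `D` lies over `Spec ℂ` and `D` is totally epimorphic and of FSMFF-type (2024), then the angular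
Frobenioid `A = A₀ ×_{D₀} D` is of FSMFF-type. [cite: MochizukiFrdII2008, Prop 3.4 (viii) p.30] -/
theorem A.isOfFSMFFType_of_isComplex' (hD : ∀ d : D, (π.obj d).IsComplex)
    (hte : IsTotallyEpimorphic D) (hFF : IsOfFSMFFType2024 D) : IsOfFSMFFType (A π) :=
  A.isOfFSMFFType_of_isComplex π hD hte hFF (fun ε hε => A0.isComplexObj_of_isFSMI ε hε)
    (fun hV ψ hψ hψ' => A0.exists_isFSMIChain_of_isFSM hV ψ hψ hψ') A0.bounded_headedFSMIChain

/-- **[FrdII] Prop. 3.4 (viii), `F = R`, complex regime — the FSMFF conclusion, CLOSED**.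
[cite: MochizukiFrdII2008, Prop 3.4 (viii) p.30] -/
theorem R.isOfFSMFFType_of_isComplex' (hD : ∀ d : D, (π.obj d).IsComplex)
    (hte : IsTotallyEpimorphic D) (hFF : IsOfFSMFFType2024 D) : IsOfFSMFFType (R π) :=
  R.isOfFSMFFType_of_isComplex π hD hte hFF (fun ε hε => R0.isComplexObj_of_isFSMI ε hε)
    R0.bounded_headedFSMIChain

/-- **[FrdII] Prop. 3.4 (viii) for `F = N`, all four conclusions, complex regime**: if every object of `D`
lies over `Spec ℂ` and `D` is RC-connected, totally epimorphic and of FSMFF-type (2024), then `N` is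
complexifiable, RC-connected, totally epimorphic and of FSMFF-type — the conclusion of the typed
`(towerN π).PropVIII` verbatim. [cite: MochizukiFrdII2008, Prop 3.4 (viii) p.30] -/
theorem N.propVIII_conclusion_of_isComplex (hD : ∀ d : D, (π.obj d).IsComplex)
    (hrc : RC.IsRCConnected (π ⋙ D0.toArchBase)) (hte : IsTotallyEpimorphic D)
    (hFF : IsOfFSMFFType2024 D) :
    RC.IsComplexifiable ((towerN π).toD0 ⋙ D0.toArchBase) ∧
      RC.IsRCConnected ((towerN π).toD0 ⋙ D0.toArchBase) ∧
        IsTotallyEpimorphic (towerN π).F ∧ IsOfFSMFFType (towerN π).F :=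
  ⟨(towerN π).rc_isComplexifiable_of_isComplex π hD, N.isRCConnected π hrc,
    (isTotallyEpimorphic_all π hte).2.2.1, N.isOfFSMFFType_of_isComplex' π hD hte hFF⟩

/-- **[FrdII] Prop. 3.4 (viii) for `F = A`, all four conclusions, complex regime**.
[cite: MochizukiFrdII2008, Prop 3.4 (viii) p.30] -/
theorem A.propVIII_conclusion_of_isComplex (hD : ∀ d : D, (π.obj d).IsComplex)
    (hrc : RC.IsRCConnected (π ⋙ D0.toArchBase)) (hte : IsTotallyEpimorphic D)
    (hFF : IsOfFSMFFType2024 D) :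
    RC.IsComplexifiable ((towerA π).toD0 ⋙ D0.toArchBase) ∧
      RC.IsRCConnected ((towerA π).toD0 ⋙ D0.toArchBase) ∧
        IsTotallyEpimorphic (towerA π).F ∧ IsOfFSMFFType (towerA π).F :=
  ⟨(towerA π).rc_isComplexifiable_of_isComplex π hD, A.isRCConnected π hrc,
    (isTotallyEpimorphic_all π hte).2.1, A.isOfFSMFFType_of_isComplex' π hD hte hFF⟩

/-- **[FrdII] Prop. 3.4 (viii) for `F = R`, all four conclusions, complex regime**.
[cite: MochizukiFrdII2008, Prop 3.4 (viii) p.30] -/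
theorem R.propVIII_conclusion_of_isComplex (hD : ∀ d : D, (π.obj d).IsComplex)
    (hrc : RC.IsRCConnected (π ⋙ D0.toArchBase)) (hte : IsTotallyEpimorphic D)
    (hFF : IsOfFSMFFType2024 D) :
    RC.IsComplexifiable ((towerR π).toD0 ⋙ D0.toArchBase) ∧
      RC.IsRCConnected ((towerR π).toD0 ⋙ D0.toArchBase) ∧
        IsTotallyEpimorphic (towerR π).F ∧ IsOfFSMFFType (towerR π).F :=
  ⟨(towerR π).rc_isComplexifiable_of_isComplex π hD, R.isRCConnected π hrc,
    (isTotallyEpimorphic_all π hte).2.2.2, R.isOfFSMFFType_of_isComplex' π hD hte hFF⟩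

/-- **[FrdII] Proposition 3.4 (viii) — the typed item `Prop34_viii π` (for `F = A, N, R`) HOLDS in the
complex regime granted the revised FSMFF hypothesis on `D`**: whenever every object of `D` lies over
`Spec ℂ`, `D` is totally epimorphic ([FrdII] Ex. 3.3 (i)) and `D` is of FSMFF-type in the 2024 sense (the
typed hypotheses "`D` complexifiable" and "`D` of FSMFF-type (2008)" inside `PropVIII` are then unnecessary
resp. superseded; RC-connectedness of `D` is consumed as typed). Compare `ArchFrd.not_prop34_viii_id`:
without the complex-regime hypothesis the typed item is false. [cite: MochizukiFrdII2008, Prop 3.4 (viii) p.30] -/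
theorem prop34_viii_of_isComplex (hD : ∀ d : D, (π.obj d).IsComplex) (hte : IsTotallyEpimorphic D)
    (hFF : IsOfFSMFFType2024 D) : Prop34_viii π :=
  ⟨fun _ hrc _ => A.propVIII_conclusion_of_isComplex π hD hrc hte hFF,
    fun _ hrc _ => N.propVIII_conclusion_of_isComplex π hD hrc hte hFF,
    fun _ hrc _ => R.propVIII_conclusion_of_isComplex π hD hrc hte hFF⟩

/-- The same with `D` of FSM-type (a category of FSM-type is of FSMFF-type in the 2024 sense,
`IsOfFSMType.isOfFSMFFType2024`; e.g. any base equivalent to `D₀`).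
[cite: MochizukiFrdII2008, Prop 3.4 (viii) p.30] -/
theorem prop34_viii_of_isComplex_of_isOfFSMType (hD : ∀ d : D, (π.obj d).IsComplex)
    (hte : IsTotallyEpimorphic D) (hF : IsOfFSMType D) : Prop34_viii π :=
  prop34_viii_of_isComplex π hD hte hF.isOfFSMFFType2024

end ArchFrd

end

end Literature.AlgebraicGeometry.Frobenioids
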